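import Literature.NumberTheory.LFunctions.RayClassPartialZetaResidue
import Literature.NumberTheory.GaloisRepresentations.HeckeLFunctionNonvanishingProofs
import HarnessLib

/-!
# `L(1, χ) ≠ 0` for every non-principal ray class character `χ mod 𝔪` of a number field

Topic `Literature/NumberTheory/LFunctions`; namespace `Literature.NumberTheory.LFunctions`. Pure-proof
file (theorems only; no definition, no named fact) joining two results already in the tree:

* **Hecke (1917)** — for a number field `K`, a nonzero ideal `𝔪` and a NON-PRINCIPAL narrow ray class
  character `χ mod 𝔪` (`IsRayClassCharacter 𝔪 ψ`, `ψ(𝔭) ≠ 1` for some `𝔭 ∤ 𝔪`), the `L`-series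
  `L(χ, s) = rayClassLSeries 𝔪 ψ s` extends to an ENTIRE function
  (`exists_differentiable_eq_rayClassLSeries`, `RayClassPartialZetaResidue.lean`, Neukirch VII (8.5)–(8.6));
* **Landau's lemma as used by Hecke–Landau** (`GaloisRepresentations.false_of_landauSeries`,
  `HeckeLFunctionNonvanishingProofs.lean`; Iwasawa, *Hecke's `L`-functions*, Prop. 4.4; Montgomery–Vaughan
  Thm. 1.7): for `|c_v| ≤ 1`, holomorphic `g, g'` on `Re s > A`, `A < 1/2`, with `g(1) = g'(1) = 0` and
  `exp F = ζ_K² g g'` on `Re s > 1` (`F` the non-negative generalized Dirichlet series attached to `c`),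
  a contradiction.

With `c_v = ψ'(v)` (`rayClassPrimeValue`: `ψ(v)` off `𝔪`, `0` on `𝔪`), `g` a continuation of `L(χ, s)`
and `g'` Hecke's entire continuation of `L(χ̄, s)` — `χ̄ = conj ∘ ψ` is again a ray class character
`mod 𝔪` (`IsRayClassCharacter.conj`), non-principal with `χ`, and `L(χ̄, σ) = conj L(χ, σ)` for real
`σ > 1` (`rayClassLSeries_conj_ofReal`) — the Euler products (8.1) (`hasProd_rayClassLSeries_rayClassPrimeValue`)
identify `∏_v (1 − c_v N v^{-s})⁻¹ ∏_v (1 − c̄_v N v^{-s})⁻¹` with `L(χ, s) L(χ̄, s)`, and we obtain: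

* `rayClassLSeries_continuation_apply_one_ne_zero` — **`L(1, χ) ≠ 0`**: every holomorphic continuation
  `g` of `L(χ, ·)` from `Re s > 1` to a half-plane `Re s > A`, `A < 1/2`, has `g(1) ≠ 0`;
* `rayClassLSeries_entire_apply_one_ne_zero` — the same for an entire continuation, and
  `exists_entire_eq_rayClassLSeries_and_apply_one_ne_zero` — Hecke's entire continuation exists and does
  not vanish at `1`.

This is the classical theorem of Hecke (1917) and Landau (1918) (*Über Ideale und Primideale in
Idealklassen*, Math. Z. 2, 52–154, §§13–16), the input of the prime ideal theorem for ray classes; for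
`K = ℚ` it is Dirichlet's `L(1, χ) ≠ 0`. For the REAL characters (`χ² = 1`) it is the field `L_one_ne`
of `SiegelFamilyData` (`SiegelTheoremAbstract.lean`) in the number-field instantiation of Siegel's
theorem (Mitsui 1956, Lemma 5; Heath-Brown, Acta Math. 186 (2001), Lemma 9.4).

## References

* K. Iwasawa, *Hecke's `L`-functions* (Princeton lectures 1964), SpringerBriefs 2019, Ch. 4 §4.2
  Prop. 4.4. [cite: Iwasawa2019, Ch. 4 §4.2 Prop. 4.4]
* J. Neukirch, *Algebraic Number Theory*, Springer 1999, Ch. VII (8.1), (8.5)–(8.6).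
  [cite: NeukirchANT1999, Ch. VII §8 Thm. (8.5)]
* E. Landau, *Über Ideale und Primideale in Idealklassen*, Math. Z. 2 (1918), 52–154. [folklore]
* H. L. Montgomery, R. C. Vaughan, *Multiplicative Number Theory I*, CUP 2007, §1.2 Thm. 1.7, §4.3.
  [cite: MontgomeryVaughan2007, §1.2 Thm. 1.7]

## Mathlib / tree search

Tree: `exists_differentiable_eq_rayClassLSeries`, `hasProd_rayClassLSeries_rayClassPrimeValue`,
`hasSum_rayClassLSeries`, `idealPow_finsuppProd`, `exists_finsuppProd_asIdeal_pow_eq`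
(`LFunctions`); `GaloisRepresentations.false_of_landauSeries`, `cexp_genDirichlet_landau_eq`,
`HeckeCharacter.continuation_apply_one_ne_zero` (the idelic version, conditional on the continuation).
`lean search 'rayClassLSeries.*one_ne_zero|one_ne_zero.*rayClass'`: nothing for `rayClassLSeries`.
Mathlib: `HasSum.map`, `Complex.continuous_conj`, `Complex.ofReal_cpow`, `map_prod`.
-/

noncomputable section

open Complex Filter Topology Set IsDedekindDomain NumberField
open scoped ComplexConjugate

namespace Literature.NumberTheory.LFunctions

variable {K : Type*} [Field K] [NumberField K]

/-! ### The conjugate character -/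

/-- `χ̄(𝔞) = conj χ(𝔞)` for a nonzero ideal `𝔞` (prime factorisation and `map_prod`). [folklore] -/
theorem idealPow_conj (ψ : HeightOneSpectrum (𝓞 K) → ℂ) {I : Ideal (𝓞 K)} (hI : I ≠ ⊥) :
    idealPow K (fun v => conj (ψ v)) I = conj (idealPow K ψ I) := by
  obtain ⟨g, rfl⟩ := exists_finsuppProd_asIdeal_pow_eq hI
  rw [idealPow_finsuppProd, idealPow_finsuppProd, Finsupp.prod, Finsupp.prod, map_prod]
  refine Finset.prod_congr rfl fun v _ => ?_
  rw [map_pow]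

/-- `rayClassCoeff` of the conjugate character is the conjugate. [folklore] -/
theorem rayClassCoeff_conj (𝔪 : Ideal (𝓞 K)) (ψ : HeightOneSpectrum (𝓞 K) → ℂ) (I : Ideal (𝓞 K)) :
    rayClassCoeff 𝔪 (fun v => conj (ψ v)) I = conj (rayClassCoeff 𝔪 ψ I) := by
  classical
  unfold rayClassCoeff
  split_ifs with h
  · exact idealPow_conj ψ h.1
  · rw [map_zero]

omit [NumberField K] in
/-- `ψ'` of the conjugate character is the conjugate of `ψ'`. [folklore] -/
theorem rayClassPrimeValue_conj (𝔪 : Ideal (𝓞 K)) (ψ : HeightOneSpectrum (𝓞 K) → ℂ)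
    (v : HeightOneSpectrum (𝓞 K)) :
    rayClassPrimeValue 𝔪 (fun v => conj (ψ v)) v = conj (rayClassPrimeValue 𝔪 ψ v) := by
  classical
  unfold rayClassPrimeValue
  split_ifs with h
  · rw [map_zero]
  · rfl

/-- **The conjugate of a ray class character `mod 𝔪` is a ray class character `mod 𝔪`.** [folklore] -/
theorem IsRayClassCharacter.conj {𝔪 : Ideal (𝓞 K)} {ψ : HeightOneSpectrum (𝓞 K) → ℂ}
    (h : IsRayClassCharacter 𝔪 ψ) : IsRayClassCharacter 𝔪 (fun v => conj (ψ v)) where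
  norm_eq_one v hv := by rw [Complex.norm_conj]; exact h.norm_eq_one v hv
  idealPow_span_eq b c hb hc hcop hbc hpos := by
    have hb' : Ideal.span {b} ≠ ⊥ := by rwa [Ne, Ideal.span_singleton_eq_bot]
    have hc' : Ideal.span {c} ≠ ⊥ := by rwa [Ne, Ideal.span_singleton_eq_bot]
    rw [idealPow_conj ψ hb', idealPow_conj ψ hc', h.idealPow_span_eq b c hb hc hcop hbc hpos]

/-- **`L(χ̄, σ) = conj L(χ, σ)` for real `σ > 1`** (conjugate the absolutely convergent series (8.1)
termwise; `𝔑(𝔞)^{-σ}` is real). [cite: NeukirchANT1999, Ch. VII §8 (8.1) Proposition] -/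
theorem rayClassLSeries_conj_ofReal {𝔪 : Ideal (𝓞 K)} (h𝔪 : 𝔪 ≠ ⊥) {ψ : HeightOneSpectrum (𝓞 K) → ℂ}
    (hψ : ∀ v : HeightOneSpectrum (𝓞 K), ¬ 𝔪 ≤ v.asIdeal → ‖ψ v‖ ≤ 1) {σ : ℝ} (hσ : 1 < σ) :
    rayClassLSeries 𝔪 (fun v => conj (ψ v)) (σ : ℂ) = conj (rayClassLSeries 𝔪 ψ (σ : ℂ)) := by
  have hs : 1 < ((σ : ℂ)).re := by rwa [ofReal_re]
  have hψ' : ∀ v : HeightOneSpectrum (𝓞 K), ¬ 𝔪 ≤ v.asIdeal → ‖conj (ψ v)‖ ≤ 1 := fun v hv => by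
    rw [Complex.norm_conj]; exact hψ v hv
  have h1 := hasSum_rayClassLSeries h𝔪 hψ hs
  have h2 := hasSum_rayClassLSeries h𝔪 hψ' hs
  have h3 : HasSum (fun I : Ideal (𝓞 K) => conj (rayClassCoeff 𝔪 ψ I * ((Ideal.absNorm I : ℕ) : ℂ) ^ (-(σ : ℂ))))
      (conj (rayClassLSeries 𝔪 ψ σ)) :=
    h1.map (starRingEnd ℂ : ℂ →+* ℂ).toAddMonoidHom Complex.continuous_conj
  refine h2.unique (h3.congr_fun fun I => ?_)
  have hreal : conj (((Ideal.absNorm I : ℕ) : ℂ) ^ (-(σ : ℂ))) = ((Ideal.absNorm I : ℕ) : ℂ) ^ (-(σ : ℂ)) := by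
    rw [show ((Ideal.absNorm I : ℕ) : ℂ) = (((Ideal.absNorm I : ℕ) : ℝ) : ℂ) by push_cast; rfl,
      show (-(σ : ℂ)) = ((-σ : ℝ) : ℂ) by push_cast; rfl,
      ← Complex.ofReal_cpow (Nat.cast_nonneg _), Complex.conj_ofReal]
  simp only [map_mul, rayClassCoeff_conj, hreal]

/-! ### `L(1, χ) ≠ 0` -/

/-- **`L(1, χ) ≠ 0` for a non-principal ray class character** (Hecke 1917, Landau 1918; Iwasawa
Prop. 4.4 at `y = 0`), continuation-agnostic form: for `𝔪 ≠ 0`, a ray class character `χ mod 𝔪` with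
`ψ(𝔭) ≠ 1` for some `𝔭 ∤ 𝔪`, and `g` holomorphic on `Re s > A` (`A < 1/2`) with `g = L(χ, ·)` on
`Re s > 1`: `g(1) ≠ 0`. Proof: Landau's lemma `false_of_landauSeries` with `c = ψ'`, `g`, and Hecke's
entire continuation `g'` of `L(χ̄, ·)` (`g'(1) = conj g(1)` by continuity from `σ > 1`).
[cite: Iwasawa2019, Ch. 4 §4.2 Prop. 4.4] -/
theorem rayClassLSeries_continuation_apply_one_ne_zero {𝔪 : Ideal (𝓞 K)} (h𝔪 : 𝔪 ≠ ⊥)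
    {ψ : HeightOneSpectrum (𝓞 K) → ℂ} (hψ : IsRayClassCharacter 𝔪 ψ)
    (hnt : ∃ v : HeightOneSpectrum (𝓞 K), ¬ 𝔪 ≤ v.asIdeal ∧ ψ v ≠ 1)
    {A : ℝ} (hA : A < 1 / 2) {g : ℂ → ℂ} (hg : DifferentiableOn ℂ g {s : ℂ | A < s.re})
    (hg_eq : ∀ s : ℂ, 1 < s.re → g s = rayClassLSeries 𝔪 ψ s) : g 1 ≠ 0 := by
  intro h0
  have hψle : ∀ v : HeightOneSpectrum (𝓞 K), ¬ 𝔪 ≤ v.asIdeal → ‖ψ v‖ ≤ 1 :=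
    fun v hv => (hψ.norm_eq_one v hv).le
  -- the conjugate character and Hecke's entire continuation of its `L`-series
  set ψc : HeightOneSpectrum (𝓞 K) → ℂ := fun v => conj (ψ v) with hψc
  have hψc' : IsRayClassCharacter 𝔪 ψc := hψ.conj
  have hψcle : ∀ v : HeightOneSpectrum (𝓞 K), ¬ 𝔪 ≤ v.asIdeal → ‖ψc v‖ ≤ 1 := fun v hv => by
    rw [hψc, Complex.norm_conj]; exact hψle v hv
  have hntc : ∃ v : HeightOneSpectrum (𝓞 K), ¬ 𝔪 ≤ v.asIdeal ∧ ψc v ≠ 1 := by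
    obtain ⟨v, hv, hv1⟩ := hnt
    refine ⟨v, hv, fun h => hv1 ?_⟩
    have := congrArg conj h
    simpa [hψc] using this
  obtain ⟨g', hg'd, hg'eq⟩ := exists_differentiable_eq_rayClassLSeries h𝔪 hψc' hntc
  -- `g'(1) = conj g(1) = 0`
  have hU : IsOpen {s : ℂ | A < s.re} := Complex.continuous_re.isOpen_preimage _ isOpen_Ioi
  have h1U : (1 : ℂ) ∈ {s : ℂ | A < s.re} := by
    simp only [Set.mem_setOf_eq, Complex.one_re]; linarith
  have hUn : {s : ℂ | A < s.re} ∈ 𝓝 (1 : ℂ) := hU.mem_nhds h1U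
  have h0' : g' 1 = 0 := by
    have hcg : ContinuousAt g 1 := (hg.differentiableAt hUn).continuousAt
    have hcg' : ContinuousAt g' 1 := (hg'd 1).continuousAt
    have hof : Tendsto (fun σ : ℝ => (σ : ℂ)) (𝓝[>] (1 : ℝ)) (𝓝 (1 : ℂ)) := by
      have h := (Complex.continuous_ofReal.tendsto (1 : ℝ)).mono_left
        (nhdsWithin_le_nhds (s := Set.Ioi (1 : ℝ)) (a := 1))
      rwa [Complex.ofReal_one] at h
    have ht1 : Tendsto (fun σ : ℝ => g' σ) (𝓝[>] (1 : ℝ)) (𝓝 (g' 1)) := hcg'.tendsto.comp hof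
    have ht2 : Tendsto (fun σ : ℝ => conj (g σ)) (𝓝[>] (1 : ℝ)) (𝓝 (conj (g 1))) :=
      (Complex.continuous_conj.tendsto _).comp (hcg.tendsto.comp hof)
    have heq : (fun σ : ℝ => conj (g σ)) =ᶠ[𝓝[>] (1 : ℝ)] fun σ : ℝ => g' σ := by
      filter_upwards [self_mem_nhdsWithin] with σ hσ
      have hσ1 : (1 : ℝ) < σ := hσ
      have hσ' : 1 < ((σ : ℂ)).re := by rwa [Complex.ofReal_re]
      rw [hg'eq _ hσ', hg_eq _ hσ', ← rayClassLSeries_conj_ofReal h𝔪 hψle hσ1]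
    have huniq := tendsto_nhds_unique (ht2.congr' heq) ht1
    rw [← huniq, h0, map_zero]
  -- the Euler products: `∏ (1 - c_v z_v)⁻¹ = L(χ, s)`, `∏ (1 - c̄_v z_v)⁻¹ = L(χ̄, s)`
  have hc : ∀ v, ‖rayClassPrimeValue 𝔪 ψ v‖ ≤ 1 := norm_rayClassPrimeValue_le hψle
  refine GaloisRepresentations.false_of_landauSeries hc hA hg (hg'd.differentiableOn) h0 h0'
    fun s hs => ?_
  rw [GaloisRepresentations.cexp_genDirichlet_landau_eq hc hs,
    (hasProd_rayClassLSeries_rayClassPrimeValue h𝔪 hψle hs).tprod_eq, ← hg_eq s hs]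
  have hconj : (fun v : HeightOneSpectrum (𝓞 K) =>
      (1 - conj (rayClassPrimeValue 𝔪 ψ v) * ((Ideal.absNorm v.asIdeal : ℕ) : ℂ) ^ (-s))⁻¹) =
      fun v => (1 - rayClassPrimeValue 𝔪 ψc v * ((Ideal.absNorm v.asIdeal : ℕ) : ℂ) ^ (-s))⁻¹ := by
    funext v; rw [rayClassPrimeValue_conj]
  rw [hconj, (hasProd_rayClassLSeries_rayClassPrimeValue h𝔪 hψcle hs).tprod_eq, ← hg'eq s hs]
  ring

/-- **`L(1, χ) ≠ 0`, entire form**: an entire continuation `g` of `L(χ, ·)` (`χ mod 𝔪` non-principal)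
has `g(1) ≠ 0`. [cite: Iwasawa2019, Ch. 4 §4.2 Prop. 4.4] -/
theorem rayClassLSeries_entire_apply_one_ne_zero {𝔪 : Ideal (𝓞 K)} (h𝔪 : 𝔪 ≠ ⊥)
    {ψ : HeightOneSpectrum (𝓞 K) → ℂ} (hψ : IsRayClassCharacter 𝔪 ψ)
    (hnt : ∃ v : HeightOneSpectrum (𝓞 K), ¬ 𝔪 ≤ v.asIdeal ∧ ψ v ≠ 1)
    {g : ℂ → ℂ} (hg : Differentiable ℂ g) (hg_eq : ∀ s : ℂ, 1 < s.re → g s = rayClassLSeries 𝔪 ψ s) :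
    g 1 ≠ 0 :=
  rayClassLSeries_continuation_apply_one_ne_zero h𝔪 hψ hnt (A := 0) one_half_pos hg.differentiableOn hg_eq

/-- **Hecke–Landau**: for a non-principal ray class character `χ mod 𝔪` there is an entire `L` with
`L(s) = L(χ, s)` for `Re s > 1` and `L(1) ≠ 0`. [cite: NeukirchANT1999, Ch. VII §8 Thm. (8.5)] -/
theorem exists_entire_eq_rayClassLSeries_and_apply_one_ne_zero {𝔪 : Ideal (𝓞 K)} (h𝔪 : 𝔪 ≠ ⊥)
    {ψ : HeightOneSpectrum (𝓞 K) → ℂ} (hψ : IsRayClassCharacter 𝔪 ψ)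
    (hnt : ∃ v : HeightOneSpectrum (𝓞 K), ¬ 𝔪 ≤ v.asIdeal ∧ ψ v ≠ 1) :
    ∃ L : ℂ → ℂ, Differentiable ℂ L ∧ (∀ s : ℂ, 1 < s.re → L s = rayClassLSeries 𝔪 ψ s) ∧ L 1 ≠ 0 := by
  obtain ⟨L, hL, hLs⟩ := exists_differentiable_eq_rayClassLSeries h𝔪 hψ hnt
  exact ⟨L, hL, hLs, rayClassLSeries_entire_apply_one_ne_zero h𝔪 hψ hnt hL hLs⟩

end Literature.NumberTheory.LFunctions

end
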